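import Summits.RiemannHypothesis.RiemannHypothesis.Theorems.SuzukiWindowsDoorExplicitWindowPolar

/-!
# SuzukiWindowsDoorExplicitWindowPolarWindows — the windows from the polar envelope of `K_θ` (column DBR; RH-FREE)

RH-FREE throughout; nothing here bears on the truth of RH (a clean window certifies nothing about RH; every
window below is a finite instance of the `∀ t`-clause of the RH-EQUIVALENT residual `AllWindowsWitness`, never
evidence for it).  Sequel of `SuzukiWindowsDoorExplicitWindowPolar` (envelope `|K_θ(x)| ≤ A x^{θ−1} e^{−βx+γx²}`,
`β = ½ + 3θ/(θ−1)`, `γ = 2θ/(θ−1)²`, `A = (2π)^{θ−1} π√(2/θ_e) (e/(θ−1))^{θ−1} e^{2θε(σ₀)}`):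
* §8.4 the weighted Hilbert–Schmidt sum `h(t) = ∫₀^T (T−u)K_θ(u)² du ≤ A² T^{2θ−2} e^{−cT}/λ²`, `T = 2t`,
  `c = 2β − 2γT`, `λ = (2θ−2)/T − c > 0` (chord `u² ≤ Tu`, tangent `u^m e^{−cu} ≤ T^m e^{−cT} e^{λ(u−T)}`,
  `∫₀^T (T−u)e^{λ(u−T)} du ≤ 1/λ²`), monotonicity of `h` in the window, and the windows
  `NoUnitEigenvalue (limKernel θ) t` for all `t ≤ T` ([Su20] Thm 1.2 (K-v) with an explicit `τ`);
* §8.5 a rational evaluation form (`e^{−y} ≤ 1/Σ_{i<N} y^i/i!`) and the instances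
  `θ = 8, 12, 20, 24, 40`: `t ≤ 0.35, 0.5, 0.84, 0.95, 1.6` (pure-power envelope: `–, 0.42, 0.66, 0.78, 1.25`).
-/

noncomputable section

-- D-0017: `Summit.<S>.<S>.…` is the designed namespace of a single-problem summit.
set_option linter.dupNamespace false

open MeasureTheory Set Filter Topology Complex

namespace Summit.RiemannHypothesis.RiemannHypothesis.Theorems.SuzukiWindowsDoorExplicitWindowPolarWindows

open Literature.NumberTheory.LFunctions
open Summit.RiemannHypothesis.RiemannHypothesis.Theorems.SuzukiWindowsDoorExplicitSymbol
open Summit.RiemannHypothesis.RiemannHypothesis.Theorems.SuzukiWindowsDoorExplicitWindow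
open Summit.RiemannHypothesis.RiemannHypothesis.Theorems.SuzukiWindowsDoorExplicitWindowPolar

/-! ## §8.4 The weighted Hilbert–Schmidt sum under the envelope (tangent bound) and the windows -/

/-- `∫₀^T (T − u) e^{λ(u−T)} du = 1/λ² − (T/λ + 1/λ²) e^{−λT} ≤ 1/λ²` for `T ≥ 0`, `λ > 0`. -/
theorem integral_weight_mul_exp_le {T l : ℝ} (hT : 0 ≤ T) (hl : 0 < l) :
    ∫ u in (0 : ℝ)..T, (T - u) * Real.exp (l * (u - T)) ≤ 1 / l ^ 2 := by
  have hl0 : l ≠ 0 := hl.ne'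
  set F : ℝ → ℝ := fun u => ((T - u) / l + 1 / l ^ 2) * Real.exp (l * (u - T)) with hF
  have hderiv : ∀ u ∈ uIcc (0 : ℝ) T, HasDerivAt F ((T - u) * Real.exp (l * (u - T))) u := by
    intro u _
    have h1 : HasDerivAt (fun v : ℝ => (T - v) / l + 1 / l ^ 2) (-1 / l) u := by
      have := ((hasDerivAt_const u T).sub (hasDerivAt_id u)).div_const l
      simpa using this.add_const (1 / l ^ 2)
    have h2 : HasDerivAt (fun v : ℝ => Real.exp (l * (v - T))) (Real.exp (l * (u - T)) * l) u := by
      have := ((hasDerivAt_id u).sub_const T).const_mul l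
      simpa using this.exp
    refine (h1.mul h2).congr_deriv ?_
    field_simp
    ring
  have hcont : Continuous fun u : ℝ => (T - u) * Real.exp (l * (u - T)) := by fun_prop
  rw [intervalIntegral.integral_eq_sub_of_hasDerivAt hderiv (hcont.intervalIntegrable _ _)]
  simp only [hF, sub_self, zero_div, zero_add, mul_zero, Real.exp_zero, mul_one, sub_zero, zero_sub]
  have hpos : 0 ≤ (T / l + 1 / l ^ 2) * Real.exp (l * -T) := by positivity
  linarith

/-- Tangent bound for the log-concave `u ↦ u^m e^{−cu}`: `u^m e^{−cu} ≤ T^m e^{−cT} e^{(m/T − c)(u − T)}` for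
`u, T > 0`, `m ≥ 0` (`log(u/T) ≤ u/T − 1`). -/
theorem rpow_mul_exp_le_tangent {u T m c : ℝ} (hu : 0 < u) (hT : 0 < T) (hm : 0 ≤ m) :
    u ^ m * Real.exp (-(c * u)) ≤ T ^ m * Real.exp (-(c * T)) * Real.exp ((m / T - c) * (u - T)) := by
  rw [Real.rpow_def_of_pos hu, Real.rpow_def_of_pos hT, ← Real.exp_add, ← Real.exp_add, ← Real.exp_add,
    Real.exp_le_exp]
  have hlog : Real.log (u / T) ≤ u / T - 1 := Real.log_le_sub_one_of_pos (by positivity)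
  rw [Real.log_div hu.ne' hT.ne'] at hlog
  have h := mul_le_mul_of_nonneg_left hlog hm
  have e : m * (u / T - 1) = (m / T - c) * (u - T) + c * u - c * T := by field_simp; ring
  nlinarith

/-- `a(u) ≤ a(T)` for `u ≤ T`, `4T ≤ 3(θ−1)` (`a(x) = 3θx/(θ−1) − 2θx²/(θ−1)²` is increasing there). -/
theorem polarExp_mono {θ u T : ℝ} (hθ : 1 < θ) (huT : u ≤ T) (hT : 4 * T ≤ 3 * (θ - 1)) :
    3 * θ * u / (θ - 1) - 2 * θ * u ^ 2 / (θ - 1) ^ 2 ≤ 3 * θ * T / (θ - 1) - 2 * θ * T ^ 2 / (θ - 1) ^ 2 := by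
  have hθ1 : 0 < θ - 1 := by linarith
  have key : 0 ≤ (T - u) * (3 * (θ - 1) - 2 * (T + u)) := mul_nonneg (by linarith) (by linarith)
  have : 3 * θ * T / (θ - 1) - 2 * θ * T ^ 2 / (θ - 1) ^ 2 - (3 * θ * u / (θ - 1) - 2 * θ * u ^ 2 / (θ - 1) ^ 2)
      = θ * ((T - u) * (3 * (θ - 1) - 2 * (T + u))) / (θ - 1) ^ 2 := by
    field_simp; ring
  have hθ0 : 0 ≤ θ := by linarith
  have : 0 ≤ θ * ((T - u) * (3 * (θ - 1) - 2 * (T + u))) / (θ - 1) ^ 2 := by positivity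
  linarith

/-- **`h(t)` under the polar envelope** (RH-free): with `T = 2t > 0`, `σ₀ ≥ 3`, `Tσ₀ ≤ θ − 1`, `2 ≤ θ_e`,
`θ_e + 2a(T) ≤ θ`, `c = 1 + 6θ/(θ−1) − 4θT/(θ−1)²`, `λ = (2θ−2)/T − c > 0`:
`∫₀^{T} (T − u) K_θ(u)² du ≤ A² T^{2θ−2} e^{−cT}/λ²`, `A = (2π)^{θ−1} π√(2/θ_e) (e/(θ−1))^{θ−1} e^{2θε(σ₀)}`. -/
theorem weightedSq_limKernel_le_polar {θ θe σ₀ t : ℝ} (hσ₀ : 3 ≤ σ₀) (ht : 0 < t)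
    (htσ : 2 * t * σ₀ ≤ θ - 1) (hθe : 2 ≤ θe)
    (hθea : θe + 2 * (3 * θ * (2 * t) / (θ - 1) - 2 * θ * (2 * t) ^ 2 / (θ - 1) ^ 2) ≤ θ)
    (hl : 0 < (2 * θ - 2) / (2 * t) - (1 + 6 * θ / (θ - 1) - 4 * θ * (2 * t) / (θ - 1) ^ 2)) :
    ∫ u in (0 : ℝ)..(2 * t), (2 * t - u) * limKernel θ u ^ 2 ≤
      ((2 * Real.pi) ^ (θ - 1) * (Real.pi * Real.sqrt (2 / θe)) * (Real.exp 1 / (θ - 1)) ^ (θ - 1)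
        * Real.exp (2 * θ * (1 / (6 * σ₀ ^ 2) + 1 / (Real.pi * σ₀ ^ 3) + Real.pi ^ 2 / 6 * (2 : ℝ) ^ (3 - σ₀)))) ^ 2
        * ((2 * t) ^ (2 * θ - 2) * Real.exp (-((1 + 6 * θ / (θ - 1) - 4 * θ * (2 * t) / (θ - 1) ^ 2) * (2 * t))))
        / ((2 * θ - 2) / (2 * t) - (1 + 6 * θ / (θ - 1) - 4 * θ * (2 * t) / (θ - 1) ^ 2)) ^ 2 := by
  set A : ℝ := (2 * Real.pi) ^ (θ - 1) * (Real.pi * Real.sqrt (2 / θe)) * (Real.exp 1 / (θ - 1)) ^ (θ - 1)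
        * Real.exp (2 * θ * (1 / (6 * σ₀ ^ 2) + 1 / (Real.pi * σ₀ ^ 3) + Real.pi ^ 2 / 6 * (2 : ℝ) ^ (3 - σ₀)))
    with hA
  set T : ℝ := 2 * t with hT
  set c : ℝ := 1 + 6 * θ / (θ - 1) - 4 * θ * T / (θ - 1) ^ 2 with hc
  set l : ℝ := (2 * θ - 2) / T - c with hldef
  have hT0 : 0 < T := by rw [hT]; linarith
  have hσ₀0 : 0 < σ₀ := by linarith
  have hθ1 : 1 < θ := by nlinarith
  have hθpos : 0 < θ - 1 := by linarith
  have hT3 : 4 * T ≤ 3 * (θ - 1) := by nlinarith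
  have hK : Continuous (limKernel θ) := Suzuki2020_thm12_continuous hθ1
  have hA0 : 0 ≤ A := by rw [hA]; positivity
  have hm : (0 : ℝ) ≤ 2 * θ - 2 := by linarith
  -- pointwise comparison on `[0, T]`
  have hpt : ∀ u ∈ Icc (0 : ℝ) T, (T - u) * limKernel θ u ^ 2 ≤
      (T - u) * (A ^ 2 * (T ^ (2 * θ - 2) * Real.exp (-(c * T))) * Real.exp (l * (u - T))) := by
    intro u hu
    refine mul_le_mul_of_nonneg_left ?_ (by linarith [hu.2])
    rcases eq_or_lt_of_le hu.1 with h0 | hu0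
    · rw [← h0, SuzukiHSWindow.apply_zero_eq_zero_of_vanishing hK (fun v hv => Suzuki2020_thm12_Kiii hθ1 hv)]
      have : (0:ℝ) ^ 2 = 0 := by norm_num
      rw [this]; positivity
    · have hau := polarExp_mono hθ1 hu.2 hT3
      have henv := abs_limKernel_le_onset_polar (θ := θ) (θe := θe) hσ₀ hu0 (by nlinarith [hu.2]) hθe
        (by linarith)
      have hsq : limKernel θ u ^ 2 = |limKernel θ u| ^ 2 := (sq_abs _).symm
      rw [hsq]
      -- square of the envelope
      have hg0 : 0 ≤ A * u ^ (θ - 1) * Real.exp (-(1 / 2 + 3 * θ / (θ - 1)) * u + 2 * θ / (θ - 1) ^ 2 * u ^ 2) := by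
        positivity
      have h1 : |limKernel θ u| ^ 2 ≤
          (A * u ^ (θ - 1) * Real.exp (-(1 / 2 + 3 * θ / (θ - 1)) * u + 2 * θ / (θ - 1) ^ 2 * u ^ 2)) ^ 2 :=
        pow_le_pow_left₀ (abs_nonneg _) henv 2
      have eu : u ^ (2 * θ - 2) = (u ^ (θ - 1)) ^ 2 := by
        rw [show (2 : ℝ) * θ - 2 = (θ - 1) * 2 by ring, Real.rpow_mul hu0.le, Real.rpow_two]
      have ee : Real.exp (2 * (-(1 / 2 + 3 * θ / (θ - 1)) * u + 2 * θ / (θ - 1) ^ 2 * u ^ 2))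
          = Real.exp (-(1 / 2 + 3 * θ / (θ - 1)) * u + 2 * θ / (θ - 1) ^ 2 * u ^ 2) ^ 2 := by
        rw [← Real.exp_nat_mul]; push_cast; ring_nf
      have h2 : (A * u ^ (θ - 1) * Real.exp (-(1 / 2 + 3 * θ / (θ - 1)) * u + 2 * θ / (θ - 1) ^ 2 * u ^ 2)) ^ 2
          = A ^ 2 * (u ^ (2 * θ - 2) * Real.exp (2 * (-(1 / 2 + 3 * θ / (θ - 1)) * u + 2 * θ / (θ - 1) ^ 2 * u ^ 2))) := by
        rw [eu, ee]; ring
      -- chord for the quadratic term: `u² ≤ T u` on `[0, T]`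
      have h3 : 2 * (-(1 / 2 + 3 * θ / (θ - 1)) * u + 2 * θ / (θ - 1) ^ 2 * u ^ 2) ≤ -(c * u) := by
        rw [hc]
        have hq : 2 * θ / (θ - 1) ^ 2 * u ^ 2 ≤ 2 * θ / (θ - 1) ^ 2 * (T * u) :=
          mul_le_mul_of_nonneg_left (by nlinarith [hu.1, hu.2]) (by positivity)
        have e : -((1 + 6 * θ / (θ - 1) - 4 * θ * T / (θ - 1) ^ 2) * u)
            = 2 * (-(1 / 2 + 3 * θ / (θ - 1)) * u) + 2 * (2 * θ / (θ - 1) ^ 2 * (T * u)) := by ring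
        rw [e]; linarith
      have h4 : u ^ (2 * θ - 2) * Real.exp (2 * (-(1 / 2 + 3 * θ / (θ - 1)) * u + 2 * θ / (θ - 1) ^ 2 * u ^ 2))
          ≤ u ^ (2 * θ - 2) * Real.exp (-(c * u)) :=
        mul_le_mul_of_nonneg_left (Real.exp_le_exp.mpr h3) (by positivity)
      have h5 := rpow_mul_exp_le_tangent (c := c) hu0 hT0 hm
      rw [show (2 * θ - 2) / T - c = l by rw [hldef]] at h5
      calc |limKernel θ u| ^ 2
          ≤ A ^ 2 * (u ^ (2 * θ - 2) * Real.exp (2 * (-(1 / 2 + 3 * θ / (θ - 1)) * u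
              + 2 * θ / (θ - 1) ^ 2 * u ^ 2))) := h1.trans h2.le
        _ ≤ A ^ 2 * (u ^ (2 * θ - 2) * Real.exp (-(c * u))) := mul_le_mul_of_nonneg_left h4 (sq_nonneg _)
        _ ≤ A ^ 2 * (T ^ (2 * θ - 2) * Real.exp (-(c * T)) * Real.exp (l * (u - T))) :=
            mul_le_mul_of_nonneg_left h5 (sq_nonneg _)
        _ = A ^ 2 * (T ^ (2 * θ - 2) * Real.exp (-(c * T))) * Real.exp (l * (u - T)) := by ring
  have hf : IntervalIntegrable (fun u => (T - u) * limKernel θ u ^ 2) volume 0 T :=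
    ((continuous_const.sub continuous_id).mul (hK.pow 2)).intervalIntegrable _ _
  have hg : IntervalIntegrable (fun u : ℝ => (T - u) * (A ^ 2 * (T ^ (2 * θ - 2) * Real.exp (-(c * T)))
      * Real.exp (l * (u - T)))) volume 0 T := by
    apply Continuous.intervalIntegrable; fun_prop
  have hW := integral_weight_mul_exp_le hT0.le hl
  have hM0 : 0 ≤ A ^ 2 * (T ^ (2 * θ - 2) * Real.exp (-(c * T))) := by positivity
  calc ∫ u in (0 : ℝ)..T, (T - u) * limKernel θ u ^ 2
      ≤ ∫ u in (0 : ℝ)..T, (T - u) * (A ^ 2 * (T ^ (2 * θ - 2) * Real.exp (-(c * T))) * Real.exp (l * (u - T))) :=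
        intervalIntegral.integral_mono_on hT0.le hf hg hpt
    _ = A ^ 2 * (T ^ (2 * θ - 2) * Real.exp (-(c * T))) * ∫ u in (0 : ℝ)..T, (T - u) * Real.exp (l * (u - T)) := by
        rw [← intervalIntegral.integral_const_mul]; congr 1; funext u; ring
    _ ≤ A ^ 2 * (T ^ (2 * θ - 2) * Real.exp (-(c * T))) * (1 / l ^ 2) := mul_le_mul_of_nonneg_left hW hM0
    _ = A ^ 2 * (T ^ (2 * θ - 2) * Real.exp (-(c * T))) / l ^ 2 := by rw [mul_one_div]

/-- Monotonicity of the weighted Hilbert–Schmidt sum in the window: `h(t) ≤ h(T)` for `0 ≤ t ≤ T`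
(continuous `K`). -/
theorem weightedSq_mono {K : ℝ → ℝ} (hK : Continuous K) {t T : ℝ} (ht : 0 ≤ t) (htT : t ≤ T) :
    ∫ u in (0 : ℝ)..(2 * t), (2 * t - u) * K u ^ 2 ≤ ∫ u in (0 : ℝ)..(2 * T), (2 * T - u) * K u ^ 2 := by
  have hf1 : IntervalIntegrable (fun u => (2 * t - u) * K u ^ 2) volume 0 (2 * t) :=
    ((continuous_const.sub continuous_id).mul (hK.pow 2)).intervalIntegrable _ _
  have hf2 : ∀ a b, IntervalIntegrable (fun u => (2 * T - u) * K u ^ 2) volume a b := fun a b =>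
    ((continuous_const.sub continuous_id).mul (hK.pow 2)).intervalIntegrable _ _
  calc ∫ u in (0 : ℝ)..(2 * t), (2 * t - u) * K u ^ 2
      ≤ ∫ u in (0 : ℝ)..(2 * t), (2 * T - u) * K u ^ 2 :=
        intervalIntegral.integral_mono_on (by linarith) hf1 (hf2 _ _) fun u _ =>
          mul_le_mul_of_nonneg_right (by linarith) (sq_nonneg _)
    _ ≤ ∫ u in (0 : ℝ)..(2 * T), (2 * T - u) * K u ^ 2 := by
        refine intervalIntegral.integral_mono_interval le_rfl (by linarith) (by linarith) ?_ (hf2 _ _)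
        refine (ae_restrict_mem measurableSet_Ioc).mono fun u hu => ?_
        exact mul_nonneg (by linarith [hu.2]) (sq_nonneg _)

/-- **EXPLICIT CLEAN WINDOWS, POLAR FORM** (RH-free; [Su20] Thm 1.2 (K-v) with an explicit `τ`): if at the window
`T > 0` the hypotheses of `weightedSq_limKernel_le_polar` hold and its bound is `< 1`, then `±1` is not an
eigenvalue of `𝖪_θ[t]` on `L²(−t,t)` for every `t ≤ T` (weighted Hilbert–Schmidt test of `SuzukiHSWindow`,
monotone in the window).  A clean window certifies nothing about RH. -/
theorem noUnitEigenvalue_limKernel_polar {θ θe σ₀ T t : ℝ} (hσ₀ : 3 ≤ σ₀) (hT : 0 < T)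
    (hTσ : 2 * T * σ₀ ≤ θ - 1) (hθe : 2 ≤ θe)
    (hθea : θe + 2 * (3 * θ * (2 * T) / (θ - 1) - 2 * θ * (2 * T) ^ 2 / (θ - 1) ^ 2) ≤ θ)
    (hl : 0 < (2 * θ - 2) / (2 * T) - (1 + 6 * θ / (θ - 1) - 4 * θ * (2 * T) / (θ - 1) ^ 2))
    (hcond : ((2 * Real.pi) ^ (θ - 1) * (Real.pi * Real.sqrt (2 / θe)) * (Real.exp 1 / (θ - 1)) ^ (θ - 1)
        * Real.exp (2 * θ * (1 / (6 * σ₀ ^ 2) + 1 / (Real.pi * σ₀ ^ 3) + Real.pi ^ 2 / 6 * (2 : ℝ) ^ (3 - σ₀)))) ^ 2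
        * ((2 * T) ^ (2 * θ - 2) * Real.exp (-((1 + 6 * θ / (θ - 1) - 4 * θ * (2 * T) / (θ - 1) ^ 2) * (2 * T))))
        / ((2 * θ - 2) / (2 * T) - (1 + 6 * θ / (θ - 1) - 4 * θ * (2 * T) / (θ - 1) ^ 2)) ^ 2 < 1)
    (ht : t ≤ T) :
    NoUnitEigenvalue (limKernel θ) t := by
  have hσ₀0 : 0 < σ₀ := by linarith
  have hθ1 : 1 < θ := by nlinarith
  rcases le_or_gt t 0 with ht0 | ht0
  · exact noUnitEigenvalue_of_small_window (M := 0) (fun u hu => by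
      have := abs_nonneg u; linarith) (by simp)
  · refine SuzukiHSWindow.limKernel_noUnitEigenvalue_of_weightedSq_lt_one hθ1 ?_
    calc ∫ u in (0 : ℝ)..(2 * t), (2 * t - u) * limKernel θ u ^ 2
        ≤ ∫ u in (0 : ℝ)..(2 * T), (2 * T - u) * limKernel θ u ^ 2 :=
          weightedSq_mono (Suzuki2020_thm12_continuous hθ1) ht0.le ht
      _ ≤ _ := weightedSq_limKernel_le_polar hσ₀ hT hTσ hθe hθea hl
      _ < 1 := hcond


/-! ## §8.5 Rational evaluation form and numeric instances -/

/-- **Numeric evaluation form, polar envelope** (RH-free): natural `θ = n ≥ 2`, `σ₀ = m ≥ 3`, rational bounds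
`π ≤ p`, `e ≤ q`, `√(2/θ_e) ≤ r`, `2nε⁺(m) ≤ α ≤ 1`, the window data `0 < T`, `2Tm ≤ n − 1`, `θ_e + 2a(2T) ≤ n`,
`λ > 0`, `c ≥ 0`, and the RATIONAL test `((2p)^{n−1} p r (q/(n−1))^{n−1}(1+α+α²))² (2T)^{2n−2} < λ² Σ_{i<N} (2cT)^i/i!`
(`e^{−2cT} ≤ 1/Σ_{i<N}(2cT)^i/i!`) give `NoUnitEigenvalue (limKernel n) t` for every `t ≤ T`. -/
theorem noUnitEigenvalue_limKernel_polar_of_rat_bounds {n m N : ℕ} (hn : 2 ≤ n) (hm : 3 ≤ m)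
    {t T p q r α θe : ℝ} (hp : Real.pi ≤ p) (hq : Real.exp 1 ≤ q) (hθe : 2 ≤ θe)
    (hθea : θe + 2 * (3 * n * (2 * T) / (n - 1) - 2 * n * (2 * T) ^ 2 / (n - 1) ^ 2) ≤ n)
    (hr : Real.sqrt (2 / θe) ≤ r)
    (ha : 2 * n * (1 / (6 * (m : ℝ) ^ 2) + 1 / (3 * (m : ℝ) ^ 3) + p ^ 2 / 6 * (8 / 2 ^ m)) ≤ α) (ha1 : α ≤ 1)
    (hT : 0 < T) (htT : t ≤ T) (hTm : 2 * T * m ≤ n - 1)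
    (hl : 0 < (2 * n - 2) / (2 * T) - (1 + 6 * n / (n - 1) - 4 * n * (2 * T) / (n - 1) ^ 2))
    (hc0 : 0 ≤ 1 + 6 * n / (n - 1) - 4 * n * (2 * T) / (n - 1) ^ 2)
    (hcond : ((2 * p) ^ (n - 1) * (p * r) * (q / (n - 1)) ^ (n - 1) * (1 + α + α ^ 2)) ^ 2
        * (2 * T) ^ (2 * n - 2)
        < ((2 * n - 2) / (2 * T) - (1 + 6 * n / (n - 1) - 4 * n * (2 * T) / (n - 1) ^ 2)) ^ 2
          * ∑ i ∈ Finset.range N,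
            ((1 + 6 * n / (n - 1) - 4 * n * (2 * T) / (n - 1) ^ 2) * (2 * T)) ^ i / (i.factorial : ℝ)) :
    NoUnitEigenvalue (limKernel n) t := by
  have hn' : (2 : ℝ) ≤ n := by exact_mod_cast hn
  have hm' : (3 : ℝ) ≤ m := by exact_mod_cast hm
  have hn1 : 0 < (n : ℝ) - 1 := by linarith
  have hm0 : 0 < (m : ℝ) := by linarith
  have hp0 : 0 ≤ p := Real.pi_pos.le.trans hp
  have hr0 : 0 ≤ r := (Real.sqrt_nonneg _).trans hr
  have hq0 : 0 ≤ q := (Real.exp_pos 1).le.trans hq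
  refine noUnitEigenvalue_limKernel_polar hm' hT hTm hθe hθea hl ?_ htT
  set X : ℝ := 2 * T with hX
  set c : ℝ := 1 + 6 * n / (n - 1) - 4 * n * X / (n - 1) ^ 2 with hc
  set l : ℝ := (2 * n - 2) / X - c with hldef
  set S : ℝ := ∑ i ∈ Finset.range N, (c * X) ^ i / (i.factorial : ℝ) with hS
  have hX0 : 0 < X := by rw [hX]; linarith
  -- casts of the exponents
  have hcast : ((n : ℝ) - 1) = ((n - 1 : ℕ) : ℝ) := by
    rw [Nat.cast_sub (by omega)]; simp
  have hrp : ∀ x : ℝ, x ^ ((n : ℝ) - 1) = x ^ (n - 1) := fun x => by rw [hcast, Real.rpow_natCast]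
  have hrp2 : ∀ x : ℝ, x ^ (2 * (n : ℝ) - 2) = x ^ (2 * n - 2) := fun x => by
    rw [show (2 : ℝ) * n - 2 = ((2 * n - 2 : ℕ) : ℝ) by
      rw [Nat.cast_sub (by omega)]; push_cast; ring, Real.rpow_natCast]
  -- `ε(m) ≤ ε⁺` and the exponential factor
  have hε : 1 / (6 * (m : ℝ) ^ 2) + 1 / (Real.pi * (m : ℝ) ^ 3) + Real.pi ^ 2 / 6 * (2 : ℝ) ^ ((3 : ℝ) - m)
      ≤ 1 / (6 * (m : ℝ) ^ 2) + 1 / (3 * (m : ℝ) ^ 3) + p ^ 2 / 6 * (8 / 2 ^ m) := by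
    have h1 : 1 / (Real.pi * (m : ℝ) ^ 3) ≤ 1 / (3 * (m : ℝ) ^ 3) := by
      have := Real.pi_gt_three.le; gcongr
    have h2 : (2 : ℝ) ^ ((3 : ℝ) - m) = 8 / 2 ^ m := by
      rw [Real.rpow_sub (by norm_num), Real.rpow_natCast, show (3 : ℝ) = ((3 : ℕ) : ℝ) by norm_num,
        Real.rpow_natCast]
      norm_num
    have h3 : Real.pi ^ 2 / 6 * (2 : ℝ) ^ ((3 : ℝ) - m) ≤ p ^ 2 / 6 * (8 / 2 ^ m) := by
      rw [h2]; gcongr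
    linarith
  have hα0 : 0 ≤ α := le_trans (by positivity) ha
  have hE : Real.exp (2 * n * (1 / (6 * (m : ℝ) ^ 2) + 1 / (Real.pi * (m : ℝ) ^ 3)
      + Real.pi ^ 2 / 6 * (2 : ℝ) ^ ((3 : ℝ) - m))) ≤ 1 + α + α ^ 2 := by
    have h := (abs_le.mp (Real.abs_exp_sub_one_sub_id_le (x := α) (by rwa [abs_of_nonneg hα0]))).2
    calc Real.exp (2 * n * (1 / (6 * (m : ℝ) ^ 2) + 1 / (Real.pi * (m : ℝ) ^ 3)
          + Real.pi ^ 2 / 6 * (2 : ℝ) ^ ((3 : ℝ) - m)))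
        ≤ Real.exp α := Real.exp_le_exp.mpr ((mul_le_mul_of_nonneg_left hε (by positivity)).trans ha)
      _ ≤ 1 + α + α ^ 2 := by linarith
  -- `e^{−cX} ≤ 1/S`
  have hS0 : 0 < S := by
    have h0 : (0 : ℝ) ≤ ((2 * p) ^ (n - 1) * (p * r) * (q / (n - 1)) ^ (n - 1) * (1 + α + α ^ 2)) ^ 2
        * X ^ (2 * n - 2) := by positivity
    have h1 : 0 < l ^ 2 * S := lt_of_le_of_lt h0 hcond
    exact pos_of_mul_pos_right h1 (sq_nonneg _)  -- fallback below if the name differs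
  have hexpS : Real.exp (-(c * X)) ≤ 1 / S := by
    rw [Real.exp_neg, ← one_div]
    exact one_div_le_one_div_of_le hS0 (Real.sum_le_exp_of_nonneg (mul_nonneg hc0 hX0.le) N)
  -- the test quantity
  have hApos : 0 < (2 * n - 2) / X - c := hl
  rw [div_lt_one (by positivity), hrp, hrp, hrp2]
  calc ((2 * Real.pi) ^ (n - 1) * (Real.pi * Real.sqrt (2 / θe)) * (Real.exp 1 / (n - 1)) ^ (n - 1)
        * Real.exp (2 * n * (1 / (6 * (m : ℝ) ^ 2) + 1 / (Real.pi * (m : ℝ) ^ 3)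
          + Real.pi ^ 2 / 6 * (2 : ℝ) ^ ((3 : ℝ) - m)))) ^ 2 * (X ^ (2 * n - 2) * Real.exp (-(c * X)))
      ≤ ((2 * p) ^ (n - 1) * (p * r) * (q / (n - 1)) ^ (n - 1) * (1 + α + α ^ 2)) ^ 2
        * (X ^ (2 * n - 2) * (1 / S)) := by gcongr
    _ = ((2 * p) ^ (n - 1) * (p * r) * (q / (n - 1)) ^ (n - 1) * (1 + α + α ^ 2)) ^ 2
        * X ^ (2 * n - 2) / S := by ring
    _ < l ^ 2 := by rw [div_lt_iff₀ hS0]; exact hcond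

/-- **θ = 12**: `±1 ∉ σ_p(𝖪₁₂[t])` for every `t ≤ 1/2` (RH-free; `σ₀ = 11`; previous file: `t ≤ 0.42`;
kit-certified numerics of record: `t_HS(12) = 0.827`). -/
theorem noUnitEigenvalue_limKernel_twelve_half {t : ℝ} (ht : t ≤ 1 / 2) : NoUnitEigenvalue (limKernel 12) t := by
  have h := noUnitEigenvalue_limKernel_polar_of_rat_bounds (n := 12) (m := 11) (N := 30) (by norm_num)
    (by norm_num) (t := t) (T := 1 / 2) (p := 3.1416) (q := 2.7182818286) (r := 11693 / 20000)
    (α := 96641 / 500000) (θe := 708 / 121) Real.pi_lt_d4.le Real.exp_one_lt_d9.le (by norm_num)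
    (by norm_num) (by rw [Real.sqrt_le_left (by norm_num)]; norm_num) (by norm_num) (by norm_num)
    (by norm_num) ht (by norm_num) (by norm_num) (by norm_num)
    (by norm_num [Finset.sum_range_succ, Nat.factorial])
  exact_mod_cast h

/-- **θ = 20**: `±1 ∉ σ_p(𝖪₂₀[t])` for every `t ≤ 21/25 = 0.84` (RH-free; `σ₀ = 11`; previous file: `0.66`). -/
theorem noUnitEigenvalue_limKernel_twenty' {t : ℝ} (ht : t ≤ 21 / 25) : NoUnitEigenvalue (limKernel 20) t := by
  have h := noUnitEigenvalue_limKernel_polar_of_rat_bounds (n := 20) (m := 11) (N := 30) (by norm_num)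
    (by norm_num) (t := t) (T := 21 / 25) (p := 3.1416) (q := 2.7182818286) (r := 2793 / 6250)
    (α := 322137 / 1000000) (θe := 451924 / 45125) Real.pi_lt_d4.le Real.exp_one_lt_d9.le (by norm_num)
    (by norm_num) (by rw [Real.sqrt_le_left (by norm_num)]; norm_num) (by norm_num) (by norm_num)
    (by norm_num) ht (by norm_num) (by norm_num) (by norm_num)
    (by norm_num [Finset.sum_range_succ, Nat.factorial])
  exact_mod_cast h

/-- **θ = 24**: `±1 ∉ σ_p(𝖪₂₄[t])` for every `t ≤ 19/20 = 0.95` (RH-free; `σ₀ = 12`; previous file: `0.78`). -/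
theorem noUnitEigenvalue_limKernel_twentyFour' {t : ℝ} (ht : t ≤ 19 / 20) :
    NoUnitEigenvalue (limKernel 24) t := by
  have h := noUnitEigenvalue_limKernel_polar_of_rat_bounds (n := 24) (m := 12) (N := 30) (by norm_num)
    (by norm_num) (t := t) (T := 19 / 20) (p := 3.1416) (q := 2.7182818286) (r := 4949 / 12500)
    (α := 219029 / 1000000) (θe := 168744 / 13225) Real.pi_lt_d4.le Real.exp_one_lt_d9.le (by norm_num)
    (by norm_num) (by rw [Real.sqrt_le_left (by norm_num)]; norm_num) (by norm_num) (by norm_num)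
    (by norm_num) ht (by norm_num) (by norm_num) (by norm_num)
    (by norm_num [Finset.sum_range_succ, Nat.factorial])
  exact_mod_cast h

/-- **θ = 40**: `±1 ∉ σ_p(𝖪₄₀[t])` for every `t ≤ 8/5` (RH-free; `σ₀ = 12`; previous file: `5/4`). -/
theorem noUnitEigenvalue_limKernel_forty' {t : ℝ} (ht : t ≤ 8 / 5) : NoUnitEigenvalue (limKernel 40) t := by
  have h := noUnitEigenvalue_limKernel_polar_of_rat_bounds (n := 40) (m := 12) (N := 32) (by norm_num)
    (by norm_num) (t := t) (T := 8 / 5) (p := 3.1416) (q := 2.7182818286) (r := 15291 / 50000)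
    (α := 365047 / 1000000) (θe := 162632 / 7605) Real.pi_lt_d4.le Real.exp_one_lt_d9.le (by norm_num)
    (by norm_num) (by rw [Real.sqrt_le_left (by norm_num)]; norm_num) (by norm_num) (by norm_num)
    (by norm_num) ht (by norm_num) (by norm_num) (by norm_num)
    (by norm_num [Finset.sum_range_succ, Nat.factorial])
  exact_mod_cast h

/-- **θ = 8**: `±1 ∉ σ_p(𝖪₈[t])` for every `t ≤ 7/20` (RH-free; `σ₀ = 9`). -/
theorem noUnitEigenvalue_limKernel_eight {t : ℝ} (ht : t ≤ 7 / 20) : NoUnitEigenvalue (limKernel 8) t := by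
  have h := noUnitEigenvalue_limKernel_polar_of_rat_bounds (n := 8) (m := 9) (N := 24) (by norm_num)
    (by norm_num) (t := t) (T := 7 / 20) (p := 3.1416) (q := 2.7182818286) (r := 37689 / 50000)
    (α := 225737 / 500000) (θe := 88 / 25) Real.pi_lt_d4.le Real.exp_one_lt_d9.le (by norm_num)
    (by norm_num) (by rw [Real.sqrt_le_left (by norm_num)]; norm_num) (by norm_num) (by norm_num)
    (by norm_num) ht (by norm_num) (by norm_num) (by norm_num)
    (by norm_num [Finset.sum_range_succ, Nat.factorial])
  exact_mod_cast h

end Summit.RiemannHypothesis.RiemannHypothesis.Theorems.SuzukiWindowsDoorExplicitWindowPolarWindows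

end
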